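import Literature.NumberTheory.Automorphic.ArchLocalStableOrbitalSumSingularTorus   -- ★ FILE B p840682 (F0P3a-p05 (g11)): the pair `C₊, C₋` (`mk_circleDiagonal_comp_eq_or`, `…_swap_ne`, `image_univ_…_eq_pair`); brings ★ B-p17 (V8)-sing
import HarnessLib

/-!
# Fibre multiplicities `2p : 2(3−p)` of the relabelling map `ρ ↦ ⟦diag(z ∘ ρ)⟧` at the split-singular torus point of `U(2,1)` — the singular twin of the regular count `p!(N−p)!`
# (Rogawski 1990 §8.2 Prop. 8.2.1 p. 118: of the three regular classes `γ, γ₁, γ₂` two collapse onto `γ₀`, one onto `γ₀′`; §8.3 p. 122)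

Topic `NumberTheory/Automorphic`; namespace `Literature.NumberTheory.Automorphic.UnitaryGroup`.  THEOREMS ONLY (no definition, no instance, no notation, no named fact, no `sorry`).
Cell `pub/hodgecm-mathlib`, ENGINE T1 (crux H413 = `stmt-HodgeConjecture-24833`); floor-1 preparation, count-neutral, under books rows #88 (ST-∞) ∕ #111 (S-d): road D2′∕ROAD-Sd, brick
**«(J-sgn) SIGNED `Φ^st_∞` AT `γ₀`» FILE D (fibre multiplicities)** (LEAD WORDS T8-34 (A) ∕ T8-44 (C), F0P3a-plan (g9); author F0P3a-p05 (g11)).  BY NAME over ★ FILE B `ArchLocalStableOrbitalSumSingularTorus`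
(p840682) and ★ B-p17 (g23) `ArchLocalSplitSingularTorusClasses` (p838884: `exists_conj_circleDiagonal_perm_of_pos_iff`).  The REGULAR twin is ★ F0P3a-p02 `card_filter_mk_circleDiagonal_eq_factorial`
(`ArchLocalStableOrbitalSumTorus`: at an injective `z` every fibre of `σ ↦ ⟦diag(z∘σ)⟧` has `p_w!(N−p_w)!` elements, whence the factor `K⁻¹ = (p_w!(N−p_w)!)⁻¹` in ★ (j2) ∕ print's «`½ Σ_{σ ∈ S₃}`»).

SETTING (`N = 3`).  A realisation `U ≤ GL₃(ℂ)` of `U(diag e)(ℂ)` (`hU`), `e_i ≠ 0`, INDEFINITE: slots `ip`, `im` with `0 < e ip`, `e im < 0`; `z : Fin 3 → Circle` two-valued with singular slot `k`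
(`z j = z k ↔ j = k`, `z` constant off `k`); `C₊ := ⟦diag(z ∘ swap k ip)⟧` («`b` over a positive slot»), `C₋ := ⟦diag(z ∘ swap k im)⟧`; `p := #{i ∣ 0 < e i}`.

WHAT IS PROVED.
* §1 **`mk_circleDiagonal_comp_eq_mk_swap_pos_iff`** (`⟦diag(z ∘ ρ)⟧ = C₊ ↔ 0 < e (ρ⁻¹ k)` — the class of a relabelled point is decided by the sign of the slot now carrying `b = z k`),
  **`mk_circleDiagonal_comp_eq_mk_swap_neg_iff`** (`… = C₋ ↔ e (ρ⁻¹ k) < 0`).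
* §2 THE COUNTS: **`card_filter_mk_circleDiagonal_comp_eq_swap_pos`** (`#{ρ ∈ S₃ ∣ ⟦diag(z∘ρ)⟧ = C₊} = 2p`), **`card_filter_mk_circleDiagonal_comp_eq_swap_neg`** (`#{… = C₋} = 2(3 − p)` as
  `2·#{i ∣ e i < 0}`), and the SUM CONVERSION **`sum_univ_perm_mk_circleDiagonal_comp_eq`**: for every `F : ConjClasses U → M` (additive commutative monoid)
  `∑ ρ : Perm (Fin 3), F ⟦diag(z ∘ ρ)⟧ = (2p) • F C₊ + (2·#{e < 0}) • F C₋` — what turns a sum over ALL relabellings (p07 (g7)'s (δ) head, the regular factor `K⁻¹`) into a CLASS sum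
  at the singular place: at a `(2,1)` place (`p = 2`, `K = 2`) `K⁻¹ Σ_ρ F = 2·F(C₊) + F(C₋)` — print's «two of `γ, γ₁, γ₂` tend to `γ₀`, one to `γ₀′`» and the `2` in «`−2cF′(γ₀′)`» (p. 123).
* §3 docked at the place `w` (`G_w = archLocal L 3 (diagonal α) w`, `e = re ∘ σ_w ∘ α`): `sum_univ_perm_mk_circleDiagonal_comp_eq_place`, and for class orbital integrals
  **`sum_univ_perm_classOrbitalIntegral_mk_circleDiagonal_comp_eq`** (`Σ_ρ Φ(⟦diag(z∘ρ)⟧, a) = 2p·Φ(C₊, a) + 2(3−p)·Φ(C₋, a)` in `ℂ`).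
HONEST LABEL: HC_CM is proved only modulo the printed citations until rung 0 closes; this file is finite bookkeeping and pays nothing by itself.

## References
* [Rogawski1990] J. D. Rogawski, *Automorphic Representations of Unitary Groups in Three Variables*, Ann. of Math. Stud. 123 (1990): §3.8 Prop. 3.8.1 pp. 30–32, §4.1 (4.1.1) p. 39,
  §8.2 Prop. 8.2.1 p. 118 (the classes `γ, γ₁, γ₂ → γ₀, γ₀, γ₀′`), p. 123 («`−2cF′(γ₀′)`»), §8.3 p. 122.
* [HornJohnson2013] R. A. Horn, C. R. Johnson, *Matrix Analysis*, 2nd ed. (2013), §4.5 Thm. 4.5.8 (Sylvester's law of inertia).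
-/

set_option autoImplicit false

noncomputable section

open MeasureTheory Matrix Equiv Finset NumberField NumberField.InfinitePlace
open Literature.LinearAlgebra.Matrix Literature.NumberTheory.Rogawski1990
open scoped MatrixGroups ComplexConjugate

namespace Literature.NumberTheory.Automorphic.UnitaryGroup

/-! ## §1 Which class a relabelled point lies in: the sign of the slot carrying `b` -/

section Generic

variable (U : Subgroup (GL (Fin 3) ℂ)) {e : Fin 3 → ℝ}

/-- Conjugacy classes of a subgroup, read on the ambient group. [folklore] -/
private theorem conjClasses_mk_eq_mk_iff_exists_coe_conj₄ {G : Type*} [Group G] {H : Subgroup G} (x y : H) :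
    ConjClasses.mk x = ConjClasses.mk y ↔ ∃ g : H, (g : G) * (x : G) * (g : G)⁻¹ = y := by
  rw [ConjClasses.mk_eq_mk_iff_isConj, isConj_iff]
  constructor
  · rintro ⟨c, hc⟩
    exact ⟨c, by rw [← hc, Subgroup.coe_mul, Subgroup.coe_mul, Subgroup.coe_inv]⟩
  · rintro ⟨g, hg⟩
    exact ⟨g, Subtype.ext (by rw [Subgroup.coe_mul, Subgroup.coe_mul, Subgroup.coe_inv]; exact hg)⟩

/-- **`⟦diag(z ∘ ρ)⟧ = C₊ ↔ 0 < e (ρ⁻¹ k)`**: the relabelled point `z ∘ ρ` carries the singular eigenvalue `b = z k` in slot `ρ⁻¹ k`, and its class is `C₊` («`b` over a positive slot»)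
exactly when that slot has positive weight (★ B-p17 `exists_conj_circleDiagonal_perm_of_pos_iff` + ★ FILE B `mk_circleDiagonal_comp_swap_ne`).
[cite: Rogawski1990, §8.3 p. 122 (§8.2 Prop. 8.2.1 p. 118); §3.8 Prop. 3.8.1 pp. 30–32] [cite: HornJohnson2013, §4.5 Thm 4.5.8] -/
theorem mk_circleDiagonal_comp_eq_mk_swap_pos_iff (hU : ∀ g : GL (Fin 3) ℂ, g ∈ U ↔ g ∈ unitaryGroupOfForm (starRingEnd ℂ) (diagonal fun i => (e i : ℂ)))
    (he : ∀ i, e i ≠ 0) {z : Fin 3 → Circle} {k : Fin 3} (hk : ∀ j, z j = z k ↔ j = k) (hzz : ∀ i j, i ≠ k → j ≠ k → z i = z j)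
    {ip im : Fin 3} (hip : 0 < e ip) (him : e im < 0) (ρ : Perm (Fin 3)) :
    ConjClasses.mk (⟨circleDiagonal 3 (z ∘ ρ), circleDiagonal_mem_of_iff 3 U hU (z ∘ ρ)⟩ : U) =
        ConjClasses.mk (⟨circleDiagonal 3 (z ∘ Equiv.swap k ip), circleDiagonal_mem_of_iff 3 U hU _⟩ : U) ↔
      0 < e (ρ.symm k) := by
  obtain rfl : U = unitaryGroupOfForm (starRingEnd ℂ) (diagonal fun i => (e i : ℂ)) := Subgroup.ext hU
  have hρ : (fun i => z ((ρ⁻¹ : Perm (Fin 3)).symm i)) = z ∘ ρ := by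
    funext i; simp only [Function.comp_apply, Perm.inv_def, Equiv.symm_symm]
  constructor
  · intro h
    by_contra hle
    have hneg : e (ρ.symm k) < 0 := lt_of_le_of_ne (not_lt.mp hle) (he _)
    -- then `z ∘ ρ` is conjugate to `z ∘ swap k im` (both carry `b` over a NEGATIVE slot), i.e. its class is `C₋` — contradicting `C₊ ≠ C₋`
    have hminus : ConjClasses.mk (⟨circleDiagonal 3 (z ∘ ρ), circleDiagonal_mem_of_iff 3 _ hU (z ∘ ρ)⟩ :
          unitaryGroupOfForm (starRingEnd ℂ) (diagonal fun i => (e i : ℂ))) =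
        ConjClasses.mk ⟨circleDiagonal 3 (z ∘ Equiv.swap k im), circleDiagonal_mem_of_iff 3 _ hU _⟩ := by
      refine (conjClasses_mk_eq_mk_iff_exists_coe_conj₄ _ _).mpr ?_
      obtain ⟨g, hg⟩ := exists_conj_circleDiagonal_perm_of_pos_iff he hk hzz ρ⁻¹ (Equiv.swap k im)
        (by rw [Equiv.swap_apply_left]; exact ⟨fun h' => (lt_irrefl _ (hneg.trans h')).elim, fun h' => (lt_irrefl _ (him.trans h')).elim⟩)
      refine ⟨g, ?_⟩
      rw [hρ] at hg
      exact hg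
    exact mk_circleDiagonal_comp_swap_ne _ hU hk hip him (h.symm.trans hminus)
  · intro hpos
    refine (conjClasses_mk_eq_mk_iff_exists_coe_conj₄ _ _).mpr ?_
    obtain ⟨g, hg⟩ := exists_conj_circleDiagonal_perm_of_pos_iff he hk hzz ρ⁻¹ (Equiv.swap k ip)
      (by rw [Equiv.swap_apply_left]; exact ⟨fun _ => hip, fun _ => hpos⟩)
    refine ⟨g, ?_⟩
    rw [hρ] at hg
    exact hg

/-- **`⟦diag(z ∘ ρ)⟧ = C₋ ↔ e (ρ⁻¹ k) < 0`** («`b` over a negative slot»). [cite: Rogawski1990, §8.3 p. 122 (§8.2 Prop. 8.2.1 p. 118)] [cite: HornJohnson2013, §4.5 Thm 4.5.8] -/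
theorem mk_circleDiagonal_comp_eq_mk_swap_neg_iff (hU : ∀ g : GL (Fin 3) ℂ, g ∈ U ↔ g ∈ unitaryGroupOfForm (starRingEnd ℂ) (diagonal fun i => (e i : ℂ)))
    (he : ∀ i, e i ≠ 0) {z : Fin 3 → Circle} {k : Fin 3} (hk : ∀ j, z j = z k ↔ j = k) (hzz : ∀ i j, i ≠ k → j ≠ k → z i = z j)
    {ip im : Fin 3} (hip : 0 < e ip) (him : e im < 0) (ρ : Perm (Fin 3)) :
    ConjClasses.mk (⟨circleDiagonal 3 (z ∘ ρ), circleDiagonal_mem_of_iff 3 U hU (z ∘ ρ)⟩ : U) =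
        ConjClasses.mk (⟨circleDiagonal 3 (z ∘ Equiv.swap k im), circleDiagonal_mem_of_iff 3 U hU _⟩ : U) ↔
      e (ρ.symm k) < 0 := by
  have hne := mk_circleDiagonal_comp_swap_ne U hU hk hip him
  have hpos := mk_circleDiagonal_comp_eq_mk_swap_pos_iff U hU he hk hzz hip him ρ
  constructor
  · intro h
    rcases lt_or_gt_of_ne (he (ρ.symm k)) with hlt | hgt
    · exact hlt
    · exact absurd ((hpos.mpr hgt).symm.trans h) hne
  · intro hlt
    rcases mk_circleDiagonal_comp_eq_or U hU he hk hzz hip him ρ with h | h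
    · exact absurd (hpos.mp h) (not_lt.mpr hlt.le)
    · exact h

/-! ## §2 The counts `2p` and `2(3 − p)`, and the sum conversion -/

/-- In `S₃`, for fixed `k, s`, exactly TWO permutations `ρ` have `ρ⁻¹ k = s` (the other two slots are permuted freely). [folklore] -/
private theorem card_filter_perm_symm_apply_eq (k s : Fin 3) : (univ.filter fun ρ : Perm (Fin 3) => ρ.symm k = s).card = 2 := by
  revert k s
  decide

open scoped Classical in
/-- Counting the relabellings by the slot that carries `b`: `#{ρ ∣ P (ρ⁻¹ k)} = 2 · #{s ∣ P s}` for any predicate `P` on slots. [folklore] -/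
private theorem card_filter_perm_symm_apply (k : Fin 3) (P : Fin 3 → Prop) :
    (univ.filter fun ρ : Perm (Fin 3) => P (ρ.symm k)).card = 2 * (univ.filter fun s => P s).card := by
  rw [Finset.card_eq_sum_card_fiberwise (f := fun ρ : Perm (Fin 3) => ρ.symm k) (t := univ.filter fun s => P s)
      (fun ρ hρ => Finset.mem_filter.mpr ⟨Finset.mem_univ _, (Finset.mem_filter.mp hρ).2⟩)]
  have hfib : ∀ b ∈ univ.filter (fun s => P s),
      ((univ.filter fun ρ : Perm (Fin 3) => P (ρ.symm k)).filter fun ρ => ρ.symm k = b).card = 2 := by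
    intro b hb
    rw [Finset.mem_filter] at hb
    have hset : ((univ.filter fun ρ : Perm (Fin 3) => P (ρ.symm k)).filter fun ρ => ρ.symm k = b) = univ.filter fun ρ : Perm (Fin 3) => ρ.symm k = b := by
      ext ρ
      simp only [Finset.mem_filter, Finset.mem_univ, true_and]
      exact ⟨fun h => h.2, fun h => ⟨h ▸ hb.2, h⟩⟩
    rw [hset, card_filter_perm_symm_apply_eq]
  rw [Finset.sum_congr rfl hfib, Finset.sum_const, smul_eq_mul, mul_comm]

open scoped Classical in
/-- **`#{ρ ∈ S₃ ∣ ⟦diag(z ∘ ρ)⟧ = C₊} = 2p`**, `p = #{i ∣ 0 < e i}` — at a `(2,1)` place FOUR of the six relabelled points lie in `C₊ = ⟦γ₀⟧` (print: the regular classes `γ, γ₁` both tend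
to `γ₀`). [cite: Rogawski1990, §8.2 Prop. 8.2.1 p. 118; §8.3 p. 122] -/
theorem card_filter_mk_circleDiagonal_comp_eq_swap_pos (hU : ∀ g : GL (Fin 3) ℂ, g ∈ U ↔ g ∈ unitaryGroupOfForm (starRingEnd ℂ) (diagonal fun i => (e i : ℂ)))
    (he : ∀ i, e i ≠ 0) {z : Fin 3 → Circle} {k : Fin 3} (hk : ∀ j, z j = z k ↔ j = k) (hzz : ∀ i j, i ≠ k → j ≠ k → z i = z j)
    {ip im : Fin 3} (hip : 0 < e ip) (him : e im < 0) :
    (univ.filter fun ρ : Perm (Fin 3) =>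
        ConjClasses.mk (⟨circleDiagonal 3 (z ∘ ρ), circleDiagonal_mem_of_iff 3 U hU (z ∘ ρ)⟩ : U) =
          ConjClasses.mk (⟨circleDiagonal 3 (z ∘ Equiv.swap k ip), circleDiagonal_mem_of_iff 3 U hU _⟩ : U)).card =
      2 * (univ.filter fun i => 0 < e i).card := by
  rw [Finset.filter_congr (fun ρ _ => mk_circleDiagonal_comp_eq_mk_swap_pos_iff U hU he hk hzz hip him ρ)]
  exact card_filter_perm_symm_apply k (fun s => 0 < e s)

open scoped Classical in
/-- **`#{ρ ∈ S₃ ∣ ⟦diag(z ∘ ρ)⟧ = C₋} = 2·#{i ∣ e i < 0}`** (`= 2(3 − p)`) — at a `(2,1)` place TWO of the six relabelled points lie in `C₋ = ⟦γ₀′⟧` (print: `γ₂ → γ₀′`).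
[cite: Rogawski1990, §8.2 Prop. 8.2.1 p. 118; §8.3 p. 122] -/
theorem card_filter_mk_circleDiagonal_comp_eq_swap_neg (hU : ∀ g : GL (Fin 3) ℂ, g ∈ U ↔ g ∈ unitaryGroupOfForm (starRingEnd ℂ) (diagonal fun i => (e i : ℂ)))
    (he : ∀ i, e i ≠ 0) {z : Fin 3 → Circle} {k : Fin 3} (hk : ∀ j, z j = z k ↔ j = k) (hzz : ∀ i j, i ≠ k → j ≠ k → z i = z j)
    {ip im : Fin 3} (hip : 0 < e ip) (him : e im < 0) :
    (univ.filter fun ρ : Perm (Fin 3) =>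
        ConjClasses.mk (⟨circleDiagonal 3 (z ∘ ρ), circleDiagonal_mem_of_iff 3 U hU (z ∘ ρ)⟩ : U) =
          ConjClasses.mk (⟨circleDiagonal 3 (z ∘ Equiv.swap k im), circleDiagonal_mem_of_iff 3 U hU _⟩ : U)).card =
      2 * (univ.filter fun i => e i < 0).card := by
  rw [Finset.filter_congr (fun ρ _ => mk_circleDiagonal_comp_eq_mk_swap_neg_iff U hU he hk hzz hip him ρ)]
  exact card_filter_perm_symm_apply k (fun s => e s < 0)

open scoped Classical in
/-- **THE SUM CONVERSION `Σ_{ρ ∈ S₃} F(⟦diag(z ∘ ρ)⟧) = (2p) • F(C₊) + (2·#{e < 0}) • F(C₋)`** for every `F` with values in an additive commutative monoid — the singular twin of the regular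
«every fibre has `p!(N−p)!` elements» (★ `card_filter_mk_circleDiagonal_eq_factorial`, whence ★ (j2)'s `K⁻¹ Σ_σ`): at a `(2,1)` place `K⁻¹ Σ_ρ F = 2·F(C₊) + F(C₋)` (`K = 2`), print's
«two of `γ, γ₁, γ₂` tend to `γ₀`, one to `γ₀′`». [cite: Rogawski1990, §8.2 Prop. 8.2.1 p. 118, p. 123; §4.1 (4.1.1) p. 39] -/
theorem sum_univ_perm_mk_circleDiagonal_comp_eq {M : Type*} [AddCommMonoid M]
    (hU : ∀ g : GL (Fin 3) ℂ, g ∈ U ↔ g ∈ unitaryGroupOfForm (starRingEnd ℂ) (diagonal fun i => (e i : ℂ)))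
    (he : ∀ i, e i ≠ 0) {z : Fin 3 → Circle} {k : Fin 3} (hk : ∀ j, z j = z k ↔ j = k) (hzz : ∀ i j, i ≠ k → j ≠ k → z i = z j)
    {ip im : Fin 3} (hip : 0 < e ip) (him : e im < 0) (F : ConjClasses U → M) :
    ∑ ρ : Perm (Fin 3), F (ConjClasses.mk (⟨circleDiagonal 3 (z ∘ ρ), circleDiagonal_mem_of_iff 3 U hU (z ∘ ρ)⟩ : U)) =
      (2 * (univ.filter fun i => 0 < e i).card) • F (ConjClasses.mk (⟨circleDiagonal 3 (z ∘ Equiv.swap k ip), circleDiagonal_mem_of_iff 3 U hU _⟩ : U)) +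
        (2 * (univ.filter fun i => e i < 0).card) • F (ConjClasses.mk (⟨circleDiagonal 3 (z ∘ Equiv.swap k im), circleDiagonal_mem_of_iff 3 U hU _⟩ : U)) := by
  set g : Perm (Fin 3) → ConjClasses U := fun ρ => ConjClasses.mk (⟨circleDiagonal 3 (z ∘ ρ), circleDiagonal_mem_of_iff 3 U hU (z ∘ ρ)⟩ : U) with hg
  have hne := mk_circleDiagonal_comp_swap_ne U hU hk hip him
  have hmaps : ∀ ρ ∈ (univ : Finset (Perm (Fin 3))), g ρ ∈ ({g (Equiv.swap k ip), g (Equiv.swap k im)} : Finset (ConjClasses U)) := fun ρ _ => by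
    rcases mk_circleDiagonal_comp_eq_or U hU he hk hzz hip him ρ with h | h
    · exact Finset.mem_insert.mpr (Or.inl h)
    · exact Finset.mem_insert_of_mem (Finset.mem_singleton.mpr h)
  rw [← Finset.sum_fiberwise_of_maps_to hmaps, Finset.sum_pair hne]
  have hfib : ∀ c : ConjClasses U, ∑ ρ ∈ univ.filter (fun ρ => g ρ = c), F (g ρ) = (univ.filter fun ρ => g ρ = c).card • F c := fun c => by
    rw [Finset.sum_congr rfl (fun ρ hρ => by rw [(Finset.mem_filter.mp hρ).2]), Finset.sum_const]
  rw [hfib, hfib, hg, card_filter_mk_circleDiagonal_comp_eq_swap_pos U hU he hk hzz hip him,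
    card_filter_mk_circleDiagonal_comp_eq_swap_neg U hU he hk hzz hip him]

end Generic

/-! ## §3 Docked at the place `w` -/

section Place

variable (L : Type) [Field L] (α : Fin 3 → L) (w : {w : InfinitePlace L // IsComplex w})

open scoped Classical in
/-- **AT THE PLACE `w`**: `Σ_{ρ ∈ S₃} F(⟦diag(z ∘ ρ)⟧) = (2·#{0 < re σ_w α_i}) • F(C₊) + (2·#{re σ_w α_i < 0}) • F(C₋)` in `G_w = archLocal L 3 (diagonal α) w` at a split-singular torus point of an indefinite place.
[cite: Rogawski1990, §8.2 Prop. 8.2.1 p. 118; §8.3 p. 122] -/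
theorem sum_univ_perm_mk_circleDiagonal_comp_eq_place {M : Type*} [AddCommMonoid M] (hα : ∀ i, α i ≠ 0) (hreal : ∀ i, (w.1.embedding (α i)).im = 0)
    {z : Fin 3 → Circle} {k : Fin 3} (hk : ∀ j, z j = z k ↔ j = k) (hzz : ∀ i j, i ≠ k → j ≠ k → z i = z j)
    {ip im : Fin 3} (hip : 0 < (w.1.embedding (α ip)).re) (him : (w.1.embedding (α im)).re < 0) (F : ConjClasses (archLocal L 3 (diagonal α) w) → M) :
    ∑ ρ : Perm (Fin 3), F (ConjClasses.mk (⟨circleDiagonal 3 (z ∘ ρ), circleDiagonal_mem_archLocal_diagonal L 3 α w (z ∘ ρ)⟩ : archLocal L 3 (diagonal α) w)) =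
      (2 * (univ.filter fun i => 0 < (w.1.embedding (α i)).re).card) •
          F (ConjClasses.mk (⟨circleDiagonal 3 (z ∘ Equiv.swap k ip), circleDiagonal_mem_archLocal_diagonal L 3 α w _⟩ : archLocal L 3 (diagonal α) w)) +
        (2 * (univ.filter fun i => (w.1.embedding (α i)).re < 0).card) •
          F (ConjClasses.mk (⟨circleDiagonal 3 (z ∘ Equiv.swap k im), circleDiagonal_mem_archLocal_diagonal L 3 α w _⟩ : archLocal L 3 (diagonal α) w)) :=
  sum_univ_perm_mk_circleDiagonal_comp_eq (archLocal L 3 (diagonal α) w) (mem_archLocal_diagonal_iff_mem_unitaryGroupOfForm L 3 α w hreal)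
    (re_embedding_ne_zero L 3 α w hα hreal) hk hzz hip him F

variable [∀ γ : archLocal L 3 (diagonal α) w, MeasurableSpace (archLocal L 3 (diagonal α) w ⧸ Subgroup.centralizer ({γ} : Set (archLocal L 3 (diagonal α) w)))]

open scoped Classical in
/-- **FOR CLASS ORBITAL INTEGRALS**: `Σ_{ρ ∈ S₃} Φ(⟦diag(z ∘ ρ)⟧, a) = 2p · Φ(C₊, a) + 2·#{e < 0} · Φ(C₋, a)` (in `ℂ`) — the singular-place bookkeeping behind the limit of ★ (j2)'s `K⁻¹ Σ_σ` as the
regular torus point tends to `γ₀`. [cite: Rogawski1990, §8.2 Prop. 8.2.1 p. 118, p. 123] -/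
theorem sum_univ_perm_classOrbitalIntegral_mk_circleDiagonal_comp_eq (hα : ∀ i, α i ≠ 0) (hreal : ∀ i, (w.1.embedding (α i)).im = 0)
    {z : Fin 3 → Circle} {k : Fin 3} (hk : ∀ j, z j = z k ↔ j = k) (hzz : ∀ i j, i ≠ k → j ≠ k → z i = z j)
    {ip im : Fin 3} (hip : 0 < (w.1.embedding (α ip)).re) (him : (w.1.embedding (α im)).re < 0)
    (m : OrbitalMeasureFamily (archLocal L 3 (diagonal α) w)) (a : archLocal L 3 (diagonal α) w → ℂ) :
    ∑ ρ : Perm (Fin 3), classOrbitalIntegral m a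
        (ConjClasses.mk (⟨circleDiagonal 3 (z ∘ ρ), circleDiagonal_mem_archLocal_diagonal L 3 α w (z ∘ ρ)⟩ : archLocal L 3 (diagonal α) w)) =
      (2 * (univ.filter fun i => 0 < (w.1.embedding (α i)).re).card : ℕ) *
          classOrbitalIntegral m a (ConjClasses.mk (⟨circleDiagonal 3 (z ∘ Equiv.swap k ip), circleDiagonal_mem_archLocal_diagonal L 3 α w _⟩ : archLocal L 3 (diagonal α) w)) +
        (2 * (univ.filter fun i => (w.1.embedding (α i)).re < 0).card : ℕ) *
          classOrbitalIntegral m a (ConjClasses.mk (⟨circleDiagonal 3 (z ∘ Equiv.swap k im), circleDiagonal_mem_archLocal_diagonal L 3 α w _⟩ : archLocal L 3 (diagonal α) w)) := by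
  rw [sum_univ_perm_mk_circleDiagonal_comp_eq_place L α w hα hreal hk hzz hip him (classOrbitalIntegral m a), nsmul_eq_mul, nsmul_eq_mul]

end Place

end Literature.NumberTheory.Automorphic.UnitaryGroup

end
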